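import Summits.Langlands.Langlands.Theses.DyadicOddResidue
import Summits.Langlands.Langlands.Theorems.DyadicDihedralFM.Negative.IrreducibleRedundant

/-!
# `ProModularClassicality` (crux stmt-Langlands-18102, route `DyadicOddResidue`): the hypotheses
# `ρ.toGaloisRep.IsIrreducible` and "unramified at all but finitely many places" are REDUNDANT
# (negative-side support, refuter crux-attack seat; hypothesis-mutation finding, sorry-free)

`ProModularClassicality` (= the named fact
`Literature.NumberTheory.Automorphic.Pan2022_proModularDeRhamClassical_GL2Q`, verbatim) quantifies
over continuous `ρ : Γ_ℚ → GL₂(ℚ̄_p)` with five hypotheses: `hres : ρ.IsResiduallyAbsIrreducible`,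
`hirr : ρ.toGaloisRep.IsIrreducible`, `hunr : ∀ᶠ v in cofinite, ρ.IsUnramifiedAt v`, the local
de Rham / distinct-weights clause at `p`, and pro-modularity
`hpro : ∃ 𝒰 : BigHeckeGLn.TameLevel 2 ℚ p, 𝒰.IsPadicallyAutomorphic ρ`.  The fact's own module
docstring (rendering (d)) says `hirr` and `hunr` "are implied by the others … and are kept only to
match the consumer's registered stub verbatim".  We record this kernel-checked:

* `eventually_isUnramifiedAt_of_isPadicallyAutomorphic` — for any number field `K`, rank `n`,
  prime `p`, coefficient ring `A` and `S`-good level datum `𝒰`, a `p`-adically automorphic `ρ` is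
  unramified at every `v ∉ 𝒰.bad` (association = unramified with prescribed Frobenius
  characteristic polynomial at ALL `v ∉ S`), and `𝒰.bad` is finite (`TameLevel.bad_finite`), so
  `ρ` is unramified at all but finitely many places;
* `hirr` follows from `hres` by the accepted
  `DyadicDihedralFM.Negative.isIrreducible_of_isResiduallyAbsIrreducible` (Burnside twice);
* `proModularClassicality_iff_core` — hence the crux is EQUIVALENT to the statement with both
  binders deleted (stated inline; no proposition is defined under `Summits/`).

Moral for provers of the crux: nothing is lost by ignoring `hirr`/`hunr`; for CONSUMERS
(`stub_classicality` of line `Sketch` of `DyadicDihedralFM`, the foreseen `ClassicalityAtTwo` of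
`DyadicEisensteinFM`) the two side conditions need not be supplied.  The load-bearing hypotheses
are `hres` (non-Eisenstein localisation — the comparison of the tree's all-degree big Hecke
algebra with Pan's degree-one `𝕋(K^p)` is only asserted there), the local clause (de Rham,
distinct weights: Pan II Thm 1.1.2 (2)) and `hpro` (Pan I Def 6.1.2).  This file does NOT refute
the crux.
-/

noncomputable section

set_option linter.dupNamespace false

namespace Summit.Langlands.Langlands.Theorems.ProModularClassicality.Negative

open scoped MatrixGroups
open Literature.NumberTheory.GaloisRepresentations Literature.NumberTheory.Automorphic
open Literature.NumberTheory.EllipticCurves.ModularForms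
open IsDedekindDomain NumberField

/-- **`p`-adically automorphic of some tame level ⇒ unramified almost everywhere.**  If `ρ` is
associated with a (continuous) point of the completed-cohomology Hecke algebra of the `S`-good
level datum `𝒰` then `ρ` is unramified at every `v ∉ S = 𝒰.bad`, a finite set
(cf. Pan, arXiv:2209.06366, Remark 1.1.4: "`ρ|G_{ℚ_l}` is unramified for all but finitely many
`l` … since `ρ` appears in `H̃¹(K^p, E)`"). [folklore] -/
theorem eventually_isUnramifiedAt_of_isPadicallyAutomorphic {n : ℕ} {K : Type} [Field K]
    [NumberField K] {p : ℕ} [Fact p.Prime] {A : Type*} [CommRing A] [TopologicalSpace A]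
    (𝒰 : BigHeckeGLn.TameLevel n K p) {ρ : FramedGaloisRep K A n}
    (h : 𝒰.IsPadicallyAutomorphic ρ) :
    ∀ᶠ v : HeightOneSpectrum (𝓞 K) in Filter.cofinite, ρ.IsUnramifiedAt v := by
  obtain ⟨x, -, hx⟩ := h
  refine Filter.eventually_cofinite.2 (𝒰.bad_finite.subset fun v hv => ?_)
  by_contra hvb
  exact hv (hx v hvb).1

/-- The same for the existentially quantified level, as it appears in the crux. [folklore] -/
theorem eventually_isUnramifiedAt_of_exists_isPadicallyAutomorphic {n : ℕ} {K : Type} [Field K]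
    [NumberField K] {p : ℕ} [Fact p.Prime] {A : Type*} [CommRing A] [TopologicalSpace A]
    {ρ : FramedGaloisRep K A n}
    (h : ∃ 𝒰 : BigHeckeGLn.TameLevel n K p, 𝒰.IsPadicallyAutomorphic ρ) :
    ∀ᶠ v : HeightOneSpectrum (𝓞 K) in Filter.cofinite, ρ.IsUnramifiedAt v := by
  obtain ⟨𝒰, h𝒰⟩ := h
  exact eventually_isUnramifiedAt_of_isPadicallyAutomorphic 𝒰 h𝒰

/-- **`hirr` and `hunr` are redundant in `ProModularClassicality`.**  The crux is equivalent to
the statement obtained by deleting the binders `ρ.toGaloisRep.IsIrreducible →` and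
`(∀ᶠ v in cofinite, ρ.IsUnramifiedAt v) →` (everything else verbatim): irreducibility is fed by
`isIrreducible_of_isResiduallyAbsIrreducible` (rank `2 > 0`), almost-everywhere unramifiedness
by `eventually_isUnramifiedAt_of_exists_isPadicallyAutomorphic`; the converse is weakening.
Hypothesis-mutation record for provers and consumers. -/
theorem proModularClassicality_iff_core :
    Summit.Langlands.Langlands.Theses.DyadicOddResidue.ProModularClassicality ↔
    (∀ (p : ℕ) [Fact p.Prime] (ρ : FramedGaloisRep ℚ (PadicAlgCl p) 2),
      ρ.IsResiduallyAbsIrreducible →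
      (∀ (v : HeightOneSpectrum (𝓞 ℚ)) (hv : ((p : ℕ) : 𝓞 ℚ) ∈ v.asIdeal),
        (Literature.NumberTheory.PAdicHodge.fontainePstAdicCompletion v p hv).IsDeRhamFramed
          (ρ.toLocal v) ∧
        ∀ τ : v.adicCompletion ℚ →+* PadicAlgCl p, Continuous τ →
          (ρ.labelledHodgeTateWeightsAt v
            (Literature.NumberTheory.PAdicHodge.fontainePstAdicCompletion v p hv).algebra
            (Literature.NumberTheory.PAdicHodge.fontainePstAdicCompletion v p hv).𝔅 τ).Nodup) →
      (∃ 𝒰 : BigHeckeGLn.TameLevel 2 ℚ p, 𝒰.IsPadicallyAutomorphic ρ) →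
      ∃ (χ : Field.absoluteGaloisGroup ℚ →ₜ* (PadicAlgCl p)ˣ) (m : ℤ),
        (∀ σ, χ σ = cyclotomicPadicAlgCl ℚ p σ ^ m) ∧
        ∃ (N : ℕ) (_ : NeZero N) (k : ℤ) (f : CuspForm (CongruenceSubgroup.Gamma1 N) k)
          (ιf : coeffCharField f →+* PadicAlgCl p),
          IsNewform1 f ∧ IsGaloisRepOfNewform1 f ιf {q | q ∣ N * p} (FramedRep.twist ρ χ)) := by
  constructor
  · intro h p _ ρ hres hdR hpro
    exact h p ρ hres
      (Summit.Langlands.Langlands.Theorems.DyadicDihedralFM.Negative.isIrreducible_of_isResiduallyAbsIrreducible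
        two_pos ρ hres)
      (eventually_isUnramifiedAt_of_exists_isPadicallyAutomorphic hpro) hdR hpro
  · intro h p _ ρ hres _ _ hdR hpro
    exact h p ρ hres hdR hpro

end Summit.Langlands.Langlands.Theorems.ProModularClassicality.Negative

end
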